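import Summits.BirchSwinnertonDyer.BirchSwinnertonDyer.Theses.PrintCFram
import Summits.BirchSwinnertonDyer.BirchSwinnertonDyer.Theorems.PrintCFramBottomClassIndexLawFiveLeEisensteinLineDataOfPrint
import Summits.BirchSwinnertonDyer.BirchSwinnertonDyer.Theorems.PrintCFramBottomClassIndexLawFiveLeEisensteinEndStatePrints7
import Summits.BirchSwinnertonDyer.BirchSwinnertonDyer.Theorems.PrintCFramBottomClassIndexLawFiveLeEisensteinEndStatePointwise
import Summits.BirchSwinnertonDyer.BirchSwinnertonDyer.Theorems.PrintCFramBottomClassIndexLawFiveLeRegularLocusBSDp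
import Summits.BirchSwinnertonDyer.BirchSwinnertonDyer.Theorems.PrintCFramBottomClassIndexLawFiveLeEisensteinEndStateV7
import Summits.BirchSwinnertonDyer.BirchSwinnertonDyer.Theorems.PrintCFramBottomClassIndexLawFiveLeEisensteinEndStateV8
import Summits.BirchSwinnertonDyer.BirchSwinnertonDyer.Theorems.PrintCFramBottomClassIndexLawFiveLeKolyvaginPairSum
import Summits.BirchSwinnertonDyer.BirchSwinnertonDyer.Theorems.PrintCFramBottomClassIndexLawFiveLePrints7OfFour
import Summits.BirchSwinnertonDyer.BirchSwinnertonDyer.Theorems.AdditiveRankOneBSDpRowKernels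
import Summits.BirchSwinnertonDyer.BirchSwinnertonDyer.Theorems.AdditivePotSupersingularControlOfFacts
import Summits.BirchSwinnertonDyer.BirchSwinnertonDyer.Theorems.RamifiedSevenEllipticUnitsStrictControlAnyPrime
import Summits.BirchSwinnertonDyer.BirchSwinnertonDyer.Theorems.RamifiedSevenEllipticUnitsRubinFormulaZpBsdp
import Summits.BirchSwinnertonDyer.BirchSwinnertonDyer.Theorems.Rank1ResidualPartitionEmptyCells
import Summits.BirchSwinnertonDyer.Rank1Residual.X12.CMRamifiedAdditive
import Summits.BirchSwinnertonDyer.Rank1Residual.Partition.CornersCM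
import Literature.NumberTheory.EllipticCurves.HeegnerPointsKolyvaginExceptionalTwistProofs
import Literature.NumberTheory.EllipticCurves.BSDSelmerCMPConverseGoldfeldProofs
import Literature.NumberTheory.EllipticCurves.AnalyticRankOrderProofs
import Literature.NumberTheory.EllipticCurves.LFunctionSmulProofs
import Summits.BirchSwinnertonDyer.BirchSwinnertonDyer.Theorems.PrintCFramBottomClassIndexLawFiveLeRegularLocusBottomLayer
import Summits.BirchSwinnertonDyer.BirchSwinnertonDyer.Theorems.PrintCFramBottomClassIndexLawFiveLeKrizLiLocusKolyvagin
import Literature.NumberTheory.EllipticCurves.ZpExtensionAnticyclotomicHoldsProofs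
import Literature.NumberTheory.EllipticCurves.BSDSelmerParityDokchitserTowerProofs
import Literature.NumberTheory.NumberFields.CongruenceSubgroupTorsionFree
import Summits.BirchSwinnertonDyer.BirchSwinnertonDyer.Theorems.PrintCFramBottomClassIndexLawFiveLeHerbrandConjugationSwapRational
import Summits.BirchSwinnertonDyer.BirchSwinnertonDyer.Theorems.PrintCFramBottomClassIndexLawFiveLeHerbrandBadPlacesSign
import Literature.NumberTheory.NumberFields.ImaginaryAbelianFieldOddChiClassNumberBridge
import Summits.BirchSwinnertonDyer.BirchSwinnertonDyer.Theorems.PrintCFramBottomClassIndexLawFiveLeHerbrandOddVanishing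
import Summits.BirchSwinnertonDyer.BirchSwinnertonDyer.Theorems.PrintCFramBottomClassIndexLawFiveLeHerbrandKummerEvenVanishingRational
import Summits.BirchSwinnertonDyer.BirchSwinnertonDyer.Theorems.PrintCFramBottomClassIndexLawFiveLeHerbrandLineDictionary
import Summits.BirchSwinnertonDyer.BirchSwinnertonDyer.Theorems.PrintCFramBottomClassIndexLawFiveLeKrizLiLocusCharacterData
import Summits.BirchSwinnertonDyer.BirchSwinnertonDyer.Theorems.PrintCFramBottomClassIndexLawFiveLeKrizLiLocusOfPrints
import Summits.BirchSwinnertonDyer.BirchSwinnertonDyer.Theorems.PrintCFramBottomClassIndexLawFiveLeKolyvaginTransport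
import Summits.BirchSwinnertonDyer.BirchSwinnertonDyer.Theorems.PrintCFramBottomClassIndexLawFiveLeEisensteinEndStateV15
import HarnessLib

/-!
# Crux `PrintCFram.BottomClassIndexLawFiveLe` (stmt-BirchSwinnertonDyer-20372), line `eisenstein-resource-bdp-line`: END STATE v16 — «ONE RESIDUE»:
# the crux from PRINT (`stub_prints`: Hsieh, LZZ, `ToricPublishedInputs`, Burungale–Flach, Mazur–Wiles Thm 2; `stub_krizLi`) and `BSD_p` OFF THE
# CHARACTER-DATA LOCUS; the v15 pair {Kolyvagin pair sum, ♭-Eisenstein inclusion} ⟹ that one statement (PROVED)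

Cell `bsd-print-cfram`, seat `bsd-line-cfram-p1` LEAD g10, `--supports stmt-BirchSwinnertonDyer-20372` (helper). THEOREMS ONLY; no definition, no named
fact, no `sorry`. BSD is not proved by any of this; no summit statement is proved by this seat; the crux C2 stays OPEN. This file is the registry-v16
composition `BottomClassIndexLawFiveLe_of` of `Cruxes/…/Lines/eisenstein_resource_bdp_line.lean` with its THREE stubs turned into hypotheses, plus the
reduction showing that END STATE v15's two research hypotheses imply v16's single one.

* (uses `EisensteinEndStateV15.not_exists_characterData_of_isIsogenous`, p663929: «no character data» moves along ℚ-isogenies).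
* `bsdp_offKrizLiChar_of_pairSum_of_flatIncl` — prints5 ∧ (pair sum off the character-data locus) ∧ (♭-inclusion off the character-data locus) ⟹
  `BSD_p(W)` for every class member with no character data (the (¬KL) branch of v15 up to k7r-c4).
* **`bottomClassIndexLawFiveLe_of_prints5_of_krizLi_of_bsdpOffChar`** — crux ⟸ (five print facts) ∧ (Kriz–Li Thm 1.20) ∧ (`BSD_p` off the character-data
  locus). With w2 g4's census: the third hypothesis is needed on 2/65 rank-one window classes (17424bl1@11, 305809c1@7); LEAD g10 report §2 (level dictionary)
  identifies its members as those whose aligned generator is `p`-divisible in `W(ℚ_p)` or whose `Ш[p] ≠ 0`.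

References: Kriz–Li 2019 Thm. 1.20; Mazur–Wiles 1984 Thm 2; Friedberg–Hoffstein 1995 Thm. B; Gross–Zagier 1986 I.(6.3); BKNO 2026 §1.4; crux workfile
`Lines/eisenstein-resource-bdp-line-lead-g10.md`.
-/

noncomputable section

open scoped Classical Pointwise

set_option linter.dupNamespace false
set_option autoImplicit false

namespace Summit.BirchSwinnertonDyer.BirchSwinnertonDyer.Theorems.PrintCFram.EisensteinEndStateV16

open WeierstrassCurve NumberField IsDedekindDomain Field PowerSeries
  Literature.NumberTheory.EllipticCurves
  Literature.NumberTheory.EllipticCurves.ModularForms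
  Literature.NumberTheory.EllipticCurves.Rank1Residual
  Literature.NumberTheory.EllipticCurves.Rank1Residual.Typed
  Literature.NumberTheory.EllipticCurves.KrizLi2019
  Literature.NumberTheory.GaloisRepresentations
  Literature.NumberTheory.GaloisCohomology
  Summit.BirchSwinnertonDyer.Rank1Residual
  Summit.BirchSwinnertonDyer.Rank1Residual.Additive
  Summit.BirchSwinnertonDyer.Rank1Residual.X11b
  Summit.BirchSwinnertonDyer.Rank1Residual.X11b.AcSelmer
  Summit.BirchSwinnertonDyer.Rank1Residual.X11b.Halves
  Summit.BirchSwinnertonDyer.Rank1Residual.X11b.CongruenceLimit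
  Summit.BirchSwinnertonDyer.Rank1Residual.X12
  Summit.BirchSwinnertonDyer.BirchSwinnertonDyer.Theses.UniversalToricDescent
  Summit.BirchSwinnertonDyer.BirchSwinnertonDyer.Theorems
  Summit.BirchSwinnertonDyer.BirchSwinnertonDyer.Theorems.SchneiderFree
  Summit.BirchSwinnertonDyer.BirchSwinnertonDyer.Theorems.SchneiderFreeControlAtoms
  Summit.BirchSwinnertonDyer.BirchSwinnertonDyer.Theorems.SchneiderFreeAdditiveX3
  Summit.BirchSwinnertonDyer.BirchSwinnertonDyer.Theorems.UniversalToricDescentWaldspurgerFlat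
  Summit.BirchSwinnertonDyer.BirchSwinnertonDyer.Theorems.AdditivePotSupersingularControl
  Summit.BirchSwinnertonDyer.BirchSwinnertonDyer.Theorems.RamifiedSevenEllipticUnits
  Summit.BirchSwinnertonDyer.BirchSwinnertonDyer.Theorems.PrintCFram
  GreenbergVatsal2000 GreenbergSelmer

/-- **v15's off-locus PAIR implies v16's ONE stub.** From the five print facts, the Kolyvagin pair-sum statement OFF the character-data locus (v15's
`stub_kolyvaginUpper_borelCM_pairSum_offKrizLi`, verbatim as a hypothesis) and the ♭-Eisenstein inclusion OFF the character-data locus (v15's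
`stub_flatEisensteinIncl_cmRamified_offKrizLi`, verbatim as a hypothesis): `BSD_p(W)` for every class member with no character data — the (¬KL) branch of the
v15 composition up to (not including) k7r-c4: root number `−1` from parity, a Friedberg–Hoffstein Heegner field `K''` with every prime `≤ 6` split (so `d`
odd `< −4`) and `L(W^{(d)},1) ≠ 0`, the pair sum at `(W, K'')`, «no character data» for both isogenous models (`not_exists_characterData_of_isIsogenous`), β1 for
both, `KrizLiKolyvagin.bsdp_cmRamified_of_flatIncl_of_isIsogenous_pairSum`. Sorry-free; CONDITIONAL on its displayed hypotheses only.
Same statement as the registered skeleton's `bsdp_offKrizLiChar_of_pairSum_of_flatIncl` (v16 §1b).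
[cite: FriedbergHoffstein1995, Thm. B] [cite: GrossZagier1986, Thm. I.(6.3)] [cite: KrizLi2019, Thm. 1.20 (pp. 7–8)] -/
theorem bsdp_offKrizLiChar_of_pairSum_of_flatIncl
    (hprints5 : Hsieh2014.thmA_exists_isHsiehLFunction_unrPeriod_anyLevel ∧
      LiuZhangZhang2018.thm151_thm153_modularCurve_heegnerVector_additive ∧
      ToricPublishedInputs ∧
      bsdTriple_of_hasCM_of_L_one_ne_zero ∧
      Literature.NumberTheory.NumberFields.MazurWiles1984.thm2_oddChiPart_classGroup_card_eq_pow_val_bernoulli)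
    (hpairSum :
    ∀ (W : WeierstrassCurve ℚ) [W.IsElliptic] [W.IsGloballyMinimal] (p : ℕ) [Fact p.Prime],
      W.HasCM → CMRamified W p → 5 ≤ p → W.analyticRank = 1 →
      (¬ ∃ (K : Type) (_ : Field K) (_ : NumberField K)
          (f : ℕ) (_ : NeZero f) (ψ : DirichletCharacter ℚ_[p] f) (ω : DirichletCharacter ℚ_[p] p)
          (εK : DirichletCharacter ℚ_[p] (NumberField.discr K).natAbs),
          IsImaginaryQuadratic K ∧ SatisfiesHeegnerHypothesis (W.conductorNorm ℤ) K ∧ Odd (NumberField.discr K) ∧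
          NumberField.discr K < -4 ∧ ψ.IsPrimitive ∧ KrizLi2019.IsTeichmullerCharacter ω ∧
          (∀ ℓ : ℕ, ℓ.Prime → ¬ (ℓ ∣ p * W.conductorNorm ℤ) →
            ‖((W.LFunction ℓ : ℤ) : ℚ_[p]) - (ψ (ℓ : ZMod f) + ψ⁻¹ (ℓ : ZMod f) * ω (ℓ : ZMod p))‖ < 1) ∧
          ψ (p : ZMod f) ≠ 1 ∧ KrizLi2019.primVal (KrizLi2019.invMulOmega ψ ω) p ≠ 1 ∧
          (∀ ℓ : ℕ, (hℓ : ℓ.Prime) → ℓ ≠ p →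
            (haveI := Fact.mk hℓ; ¬ W.HasGoodReductionAtPrime ℓ ∧ ¬ W.HasMultiplicativeReductionAtPrime ℓ) →
            ψ (ℓ : ZMod f) ≠ 1 ∧ KrizLi2019.primVal (KrizLi2019.invMulOmega ψ ω) ℓ ≠ 1) ∧
          KrizLi2019.IsKroneckerCharacterOf K εK ∧
          ¬ (‖KrizLi2019.bernoulliOnePrim (KrizLi2019.bernoulliCharOne ψ εK) *
              KrizLi2019.bernoulliOnePrim (KrizLi2019.bernoulliCharTwo ψ εK ω)‖ ≤ (p : ℝ)⁻¹)) →
      ∀ (N : ℕ) [NeZero N] (K : Type) [Field K] [NumberField K],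
        W.conductorNorm ℤ = N → IsImaginaryQuadratic K → Odd (NumberField.discr K) → NumberField.discr K < -4 →
        SatisfiesHeegnerHypothesis N K → (W.quadraticTwist (NumberField.discr K : ℚ)).entireLFunction 1 ≠ 0 →
        ∃ (W₀ : WeierstrassCurve ℚ) (_ : W₀.IsElliptic) (_ : W₀.IsGloballyMinimal)
          (W₁ : WeierstrassCurve ℚ) (_ : W₁.IsElliptic) (_ : W₁.IsGloballyMinimal)
          (Dt₀ : ModularParametrizationData W₀ N) (H₀ : HeegnerDatum N (NumberField.discr K)) (ι₀ : K →+* ℂ)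
          (P₀ : (W₀.baseChange K).toAffine.Point)
          (Dt₁ : ModularParametrizationData W₁ N) (H₁ : HeegnerDatum N (NumberField.discr K)) (ι₁ : K →+* ℂ)
          (P₁ : (W₁.baseChange K).toAffine.Point),
          IsIsogenous W W₀ ∧ IsIsogenous W W₁ ∧
          WeierstrassCurve.Affine.Point.map ι₀.toRatAlgHom P₀ = heegnerPointComplex Dt₀ H₀ ∧
          WeierstrassCurve.Affine.Point.map ι₁.toRatAlgHom P₁ = heegnerPointComplex Dt₁ H₁ ∧
          padicValNat p (W₀.baseChange K).shaOrder + 2 * padicValNat p Dt₀.c.natAbs +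
              (padicValNat p (W₁.baseChange K).shaOrder + 2 * padicValNat p Dt₁.c.natAbs) ≤
            2 * padicValNat p (AddSubgroup.zmultiples P₀).index + 2 * padicValNat p (AddSubgroup.zmultiples P₁).index)
    (hflat :
    ∀ (p : ℕ) [Fact p.Prime] (W : WeierstrassCurve ℚ) [W.IsElliptic] [W.IsGloballyMinimal],
      W.HasCM → CMRamified W p → 5 ≤ p → W.analyticRank = 1 →
      (¬ ∃ (K : Type) (_ : Field K) (_ : NumberField K)
          (f : ℕ) (_ : NeZero f) (ψ : DirichletCharacter ℚ_[p] f) (ω : DirichletCharacter ℚ_[p] p)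
          (εK : DirichletCharacter ℚ_[p] (NumberField.discr K).natAbs),
          IsImaginaryQuadratic K ∧ SatisfiesHeegnerHypothesis (W.conductorNorm ℤ) K ∧ Odd (NumberField.discr K) ∧
          NumberField.discr K < -4 ∧ ψ.IsPrimitive ∧ KrizLi2019.IsTeichmullerCharacter ω ∧
          (∀ ℓ : ℕ, ℓ.Prime → ¬ (ℓ ∣ p * W.conductorNorm ℤ) →
            ‖((W.LFunction ℓ : ℤ) : ℚ_[p]) - (ψ (ℓ : ZMod f) + ψ⁻¹ (ℓ : ZMod f) * ω (ℓ : ZMod p))‖ < 1) ∧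
          ψ (p : ZMod f) ≠ 1 ∧ KrizLi2019.primVal (KrizLi2019.invMulOmega ψ ω) p ≠ 1 ∧
          (∀ ℓ : ℕ, (hℓ : ℓ.Prime) → ℓ ≠ p →
            (haveI := Fact.mk hℓ; ¬ W.HasGoodReductionAtPrime ℓ ∧ ¬ W.HasMultiplicativeReductionAtPrime ℓ) →
            ψ (ℓ : ZMod f) ≠ 1 ∧ KrizLi2019.primVal (KrizLi2019.invMulOmega ψ ω) ℓ ≠ 1) ∧
          KrizLi2019.IsKroneckerCharacterOf K εK ∧
          ¬ (‖KrizLi2019.bernoulliOnePrim (KrizLi2019.bernoulliCharOne ψ εK) *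
              KrizLi2019.bernoulliOnePrim (KrizLi2019.bernoulliCharTwo ψ εK ω)‖ ≤ (p : ℝ)⁻¹)) →
      ∀ (N : ℕ) [NeZero N] (K : Type) [Field K] [NumberField K] (Dt : ModularParametrizationData W N),
      W.conductorNorm ℤ = N → IsImaginaryQuadratic K → SatisfiesHeegnerHypothesis N K →
      ∀ (κ : ZpExtension K p), κ.IsAnticyclotomic → ∀ (γ : Field.absoluteGaloisGroup K) [Fact (κ.IsTopGenerator γ)]
        (𝔭 : HeightOneSpectrum (𝓞 K)), ((p : ℕ) : 𝓞 K) ∈ 𝔭.asIdeal → 𝔭.asIdeal.ramificationIdx (𝓞 ℚ) = 1 →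
        𝔭.asIdeal.inertiaDeg (𝓞 ℚ) = 1 → ∀ (𝔭' : HeightOneSpectrum (𝓞 K)), ((p : ℕ) : 𝓞 K) ∈ 𝔭'.asIdeal → 𝔭' ≠ 𝔭 →
        ∀ (ι' : PadicAlgCl p ≃+* ℂ), SchneiderFree.BranchInducesPrime p ι' 𝔭 →
        ∀ (ΩK : ℂ) (Ωp : ℂ_[p]) (Q : PowerSeries (PadicComplexInt p)), ΩK ≠ 0 → Ωp ≠ 0 →
          R1.IsBDPLFunctionInt p ι' 𝔭 κ γ Dt.f ΩK Ωp Q →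
          Module.IsTorsion (IwasawaAlgebra p) (XAc (W.baseChange K) p κ 𝔭' ∅ γ) →
          (XAc.charIdeal (W.baseChange K) p κ 𝔭' ∅ γ).map (PowerSeries.map (R1.toCpInt p)) ≤ Ideal.span {Q}) :
    ∀ (W : WeierstrassCurve ℚ) [W.IsElliptic] [W.IsGloballyMinimal] (p : ℕ) [Fact p.Prime],
      W.HasCM → CMRamified W p → 5 ≤ p → W.analyticRank = 1 →
      (¬ ∃ (K : Type) (_ : Field K) (_ : NumberField K)
          (f : ℕ) (_ : NeZero f) (ψ : DirichletCharacter ℚ_[p] f) (ω : DirichletCharacter ℚ_[p] p)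
          (εK : DirichletCharacter ℚ_[p] (NumberField.discr K).natAbs),
          IsImaginaryQuadratic K ∧ SatisfiesHeegnerHypothesis (W.conductorNorm ℤ) K ∧ Odd (NumberField.discr K) ∧
          NumberField.discr K < -4 ∧ ψ.IsPrimitive ∧ KrizLi2019.IsTeichmullerCharacter ω ∧
          (∀ ℓ : ℕ, ℓ.Prime → ¬ (ℓ ∣ p * W.conductorNorm ℤ) →
            ‖((W.LFunction ℓ : ℤ) : ℚ_[p]) - (ψ (ℓ : ZMod f) + ψ⁻¹ (ℓ : ZMod f) * ω (ℓ : ZMod p))‖ < 1) ∧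
          ψ (p : ZMod f) ≠ 1 ∧ KrizLi2019.primVal (KrizLi2019.invMulOmega ψ ω) p ≠ 1 ∧
          (∀ ℓ : ℕ, (hℓ : ℓ.Prime) → ℓ ≠ p →
            (haveI := Fact.mk hℓ; ¬ W.HasGoodReductionAtPrime ℓ ∧ ¬ W.HasMultiplicativeReductionAtPrime ℓ) →
            ψ (ℓ : ZMod f) ≠ 1 ∧ KrizLi2019.primVal (KrizLi2019.invMulOmega ψ ω) ℓ ≠ 1) ∧
          KrizLi2019.IsKroneckerCharacterOf K εK ∧
          ¬ (‖KrizLi2019.bernoulliOnePrim (KrizLi2019.bernoulliCharOne ψ εK) *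
              KrizLi2019.bernoulliOnePrim (KrizLi2019.bernoulliCharTwo ψ εK ω)‖ ≤ (p : ℝ)⁻¹)) →
      BSDp W p := by
  intro W _ _ p _ hCM hram h5 hr hCD
  have hprints := Theorems.PrintCFram.InputsPrints.prints7_of_prints4
    ⟨hprints5.1, hprints5.2.1, hprints5.2.2.1, hprints5.2.2.2.1⟩
  obtain ⟨-, -, hF, -, -, hmod, hCassels⟩ := id hprints
  obtain ⟨hGZ, hKo, hGZK, -, hmodP, -, hGZ73, hFH, hpar, hHP⟩ := id hF
  haveI hN0 : NeZero (W.conductorNorm ℤ) := ⟨W.conductorNorm_pos_holds.ne'⟩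
  have hw : W.rootNumber = -1 := by
    rcases W.rootNumber_eq_one_or with h | h
    · exfalso
      have heven : Even W.analyticRank := (hpar W).mpr h
      rw [hr] at heven
      exact Nat.not_even_one heven
    · exact h
  obtain ⟨K, _, _, hK, -, hHN, hH6, hLt⟩ := hFH W hw 6 (by norm_num) 0
  have hodd : Odd (NumberField.discr K) := by
    have h8 := Literature.SatisfiesHeegnerHypothesis.discr_emod_eight hK.1 hH6 (by norm_num : (2 : ℕ) ∣ 6)
    rw [Int.odd_iff]; omega
  have hd4 : NumberField.discr K < -4 :=
    UniversalToricDescentWaldspurgerFlat.discr_lt_neg_four_of_three_split hK (hH6 3 Nat.prime_three (by norm_num : (3 : ℕ) ∣ 6))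
  obtain ⟨W₀, _, _, W₁, _, _, Dt₀, H₀, ι₀, P₀, Dt₁, H₁, ι₁, P₁, hiso₀, hiso₁, hP₀, hP₁, hsum⟩ :=
    hpairSum W p hCM hram h5 hr hCD (W.conductorNorm ℤ) K rfl hK hodd hd4 hHN hLt
  have hCM₀ : W₀.HasCM := X12.hasCM_of_isIsogenous hiso₀ hCM
  have hram₀ : CMRamified W₀ p := (X12.cmRamified_iff_of_isIsogenous hiso₀ hCM p).mp hram
  have hr₀ : W₀.analyticRank = 1 := by
    rw [← analyticRank_eq_of_isIsogenous LFunction_eq_of_isIsogenous_holds hiso₀]; exact hr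
  have hN₀ : W₀.conductorNorm ℤ = W.conductorNorm ℤ := (conductorNorm_eq_of_isIsogenous_of_modularity hmodP W W₀ hiso₀).symm
  have hCM₁ : W₁.HasCM := X12.hasCM_of_isIsogenous hiso₁ hCM
  have hram₁ : CMRamified W₁ p := (X12.cmRamified_iff_of_isIsogenous hiso₁ hCM p).mp hram
  have hr₁ : W₁.analyticRank = 1 := by
    rw [← analyticRank_eq_of_isIsogenous LFunction_eq_of_isIsogenous_holds hiso₁]; exact hr
  have hN₁ : W₁.conductorNorm ℤ = W.conductorNorm ℤ := (conductorNorm_eq_of_isIsogenous_of_modularity hmodP W W₁ hiso₁).symm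
  have hCD₀ := EisensteinEndStateV15.not_exists_characterData_of_isIsogenous (p := p) hF hiso₀ hCM₀ hCD
  have hCD₁ := EisensteinEndStateV15.not_exists_characterData_of_isIsogenous (p := p) hF hiso₁ hCM₁ hCD
  exact Theorems.PrintCFram.KrizLiKolyvagin.bsdp_cmRamified_of_flatIncl_of_isIsogenous_pairSum hprints W hCM hram h5 hr (W.conductorNorm ℤ)
    K rfl hK hHN hodd hd4 hLt W₀ hiso₀ W₁ hiso₁ Dt₀ H₀ ι₀ P₀ hP₀ Dt₁ H₁ ι₁ P₁ hP₁
    (fun κ hκ γ _ 𝔭 h𝔭 he hf 𝔭' h𝔭' hne ι' hind ΩK Ωp Q hΩK hΩp hBDP htors ↦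
      hflat p W₀ hCM₀ hram₀ h5 hr₀ hCD₀ (W.conductorNorm ℤ) K Dt₀ hN₀ hK hHN κ hκ γ 𝔭 h𝔭 he hf 𝔭' h𝔭' hne ι' hind ΩK Ωp Q hΩK hΩp hBDP htors)
    (fun κ hκ γ _ 𝔭 h𝔭 he hf 𝔭' h𝔭' hne ι' hind ΩK Ωp Q hΩK hΩp hBDP htors ↦
      hflat p W₁ hCM₁ hram₁ h5 hr₁ hCD₁ (W.conductorNorm ℤ) K Dt₁ hN₁ hK hHN κ hκ γ 𝔭 h𝔭 he hf 𝔭' h𝔭' hne ι' hind ΩK Ωp Q hΩK hΩp hBDP htors)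
    hsum

/-- **END STATE v16 of line `eisenstein-resource-bdp-line` on crux C2 `BottomClassIndexLawFiveLe` («ONE RESIDUE»).** The crux follows from:
(1) `hprints5` — the five print facts of `stub_prints`; (2) `hKL` — Kriz–Li 2019 Thm. 1.20; (3) `hB` — `BSD_p(W)` for every class member with NO CHARACTER
DATA (v16's `stub_bsdp_offKrizLiChar`, verbatim). Proof = the registered v16 composition: split on character data; (KL) w6 g2's «character data ⟹ Kriz–Li
datum» then w7 g2's print-only (KL) branch (p662184); (¬KL) `hB` then k7r-c4's `ramifiedCMBottomClassIndexLawAtZp_of_bsdp` (Cassels, modularity, GZK inside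
`ToricPublishedInputs`). CONDITIONAL on (1)–(3); (3) is OPEN (BKNO 2026 §1.4, barrier `CMRankOneAtRamifiedPrime`); BSD is not proved by any of this.
[cite: KrizLi2019, Thm. 1.20 (pp. 7–8), Rem. 1.21 (p. 8)] [cite: MazurWiles1984, Thm. 2 (p. 216)] [cite: Cassels1965ArithmeticVIII]
[cite: BurungaleKobayashiNakamuraOta2026, §1.4 (arXiv:2608.06879 p. 8)] -/
theorem bottomClassIndexLawFiveLe_of_prints5_of_krizLi_of_bsdpOffChar
    (hprints5 :
    Hsieh2014.thmA_exists_isHsiehLFunction_unrPeriod_anyLevel ∧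
    LiuZhangZhang2018.thm151_thm153_modularCurve_heegnerVector_additive ∧
    ToricPublishedInputs ∧
    bsdTriple_of_hasCM_of_L_one_ne_zero ∧
    Literature.NumberTheory.NumberFields.MazurWiles1984.thm2_oddChiPart_classGroup_card_eq_pow_val_bernoulli)
    (hKL : KrizLi2019.thm120_padicLogHeegner_unit_of_bernoulli)
    (hB :
    ∀ (W : WeierstrassCurve ℚ) [W.IsElliptic] [W.IsGloballyMinimal] (p : ℕ) [Fact p.Prime],
      W.HasCM → CMRamified W p → 5 ≤ p → W.analyticRank = 1 →
      (¬ ∃ (K : Type) (_ : Field K) (_ : NumberField K)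
          (f : ℕ) (_ : NeZero f) (ψ : DirichletCharacter ℚ_[p] f) (ω : DirichletCharacter ℚ_[p] p)
          (εK : DirichletCharacter ℚ_[p] (NumberField.discr K).natAbs),
          IsImaginaryQuadratic K ∧ SatisfiesHeegnerHypothesis (W.conductorNorm ℤ) K ∧ Odd (NumberField.discr K) ∧
          NumberField.discr K < -4 ∧ ψ.IsPrimitive ∧ KrizLi2019.IsTeichmullerCharacter ω ∧
          (∀ ℓ : ℕ, ℓ.Prime → ¬ (ℓ ∣ p * W.conductorNorm ℤ) →
            ‖((W.LFunction ℓ : ℤ) : ℚ_[p]) - (ψ (ℓ : ZMod f) + ψ⁻¹ (ℓ : ZMod f) * ω (ℓ : ZMod p))‖ < 1) ∧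
          ψ (p : ZMod f) ≠ 1 ∧ KrizLi2019.primVal (KrizLi2019.invMulOmega ψ ω) p ≠ 1 ∧
          (∀ ℓ : ℕ, (hℓ : ℓ.Prime) → ℓ ≠ p →
            (haveI := Fact.mk hℓ; ¬ W.HasGoodReductionAtPrime ℓ ∧ ¬ W.HasMultiplicativeReductionAtPrime ℓ) →
            ψ (ℓ : ZMod f) ≠ 1 ∧ KrizLi2019.primVal (KrizLi2019.invMulOmega ψ ω) ℓ ≠ 1) ∧
          KrizLi2019.IsKroneckerCharacterOf K εK ∧
          ¬ (‖KrizLi2019.bernoulliOnePrim (KrizLi2019.bernoulliCharOne ψ εK) *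
              KrizLi2019.bernoulliOnePrim (KrizLi2019.bernoulliCharTwo ψ εK ω)‖ ≤ (p : ℝ)⁻¹)) →
      BSDp W p) :
    Summit.BirchSwinnertonDyer.BirchSwinnertonDyer.Theses.PrintCFram.BottomClassIndexLawFiveLe := by
  intro _hGZK W _ _ p _ hCM hram h5 hr
  have hprints := Theorems.PrintCFram.InputsPrints.prints7_of_prints4
    ⟨hprints5.1, hprints5.2.1, hprints5.2.2.1, hprints5.2.2.2.1⟩
  by_cases hCD : ∃ (K : Type) (_ : Field K) (_ : NumberField K)
      (f : ℕ) (_ : NeZero f) (ψ : DirichletCharacter ℚ_[p] f) (ω : DirichletCharacter ℚ_[p] p)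
      (εK : DirichletCharacter ℚ_[p] (NumberField.discr K).natAbs),
      IsImaginaryQuadratic K ∧ SatisfiesHeegnerHypothesis (W.conductorNorm ℤ) K ∧ Odd (NumberField.discr K) ∧
      NumberField.discr K < -4 ∧ ψ.IsPrimitive ∧ KrizLi2019.IsTeichmullerCharacter ω ∧
      (∀ ℓ : ℕ, ℓ.Prime → ¬ (ℓ ∣ p * W.conductorNorm ℤ) →
        ‖((W.LFunction ℓ : ℤ) : ℚ_[p]) - (ψ (ℓ : ZMod f) + ψ⁻¹ (ℓ : ZMod f) * ω (ℓ : ZMod p))‖ < 1) ∧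
      ψ (p : ZMod f) ≠ 1 ∧ KrizLi2019.primVal (KrizLi2019.invMulOmega ψ ω) p ≠ 1 ∧
      (∀ ℓ : ℕ, (hℓ : ℓ.Prime) → ℓ ≠ p →
        (haveI := Fact.mk hℓ; ¬ W.HasGoodReductionAtPrime ℓ ∧ ¬ W.HasMultiplicativeReductionAtPrime ℓ) →
        ψ (ℓ : ZMod f) ≠ 1 ∧ KrizLi2019.primVal (KrizLi2019.invMulOmega ψ ω) ℓ ≠ 1) ∧
      KrizLi2019.IsKroneckerCharacterOf K εK ∧
      ¬ (‖KrizLi2019.bernoulliOnePrim (KrizLi2019.bernoulliCharOne ψ εK) *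
          KrizLi2019.bernoulliOnePrim (KrizLi2019.bernoulliCharTwo ψ εK ω)‖ ≤ (p : ℝ)⁻¹)
  · -- (KL) character data ⟹ a Kriz–Li datum (w6 g2) ⟹ PRINT ONLY (w7 g2's one-call (KL) branch = v14's branch verbatim)
    exact Theorems.PrintCFram.KrizLiLocusOfPrints.ramifiedCMBottomClassIndexLawAtZp_of_krizLiDatum_of_prints hprints5 hKL
      W hCM hram h5 hr
      ((Theorems.PrintCFram.KrizLiLValueFree.exists_krizLiDatum_iff_exists_characterData hKL hprints5.2.2.1
        W hCM hram h5 hr).mpr hCD)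
  · -- (¬KL) no character data: Stub B gives `BSD_p(W)`, k7r-c4 (Cassels, modularity, GZK — inside `ToricPublishedInputs`) the class law
    obtain ⟨-, -, ⟨-, -, hGZK, -⟩, -, -, hmod, hCassels⟩ := id hprints
    exact RubinFormulaZpBsdp.ramifiedCMBottomClassIndexLawAtZp_of_bsdp hCassels hmod hGZK hr.le
      (hB W p hCM hram h5 hr hCD)

end Summit.BirchSwinnertonDyer.BirchSwinnertonDyer.Theorems.PrintCFram.EisensteinEndStateV16

end
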